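import Literature.AlgebraicTopology.SingularHomology.HomologySelfMapFixingOpenSet
import Literature.AlgebraicTopology.SingularHomology.CohomologySelfMapTransferOfField
import Mathlib.LinearAlgebra.Trace
import Mathlib.Algebra.Module.Projective
import HarnessLib

/-!
# The Lefschetz trace of a self-map which is the identity on an open set LOCALISES to the invariant piece
# (`tr(h_* − 1 | Hₙ(X)) = tr((h|_A)_* − 1 | Hₙ(A))`, degree by degree, with no hypothesis on the overlap)

Layer `Literature/AlgebraicTopology/SingularHomology`; theorems only (no definition, no named fact). Written by the
prover seat `hodge-nonav-prover-Bx` (g16, cell `hodge-nonav`) as brick B3 of the programme «A₃-TRACE» for the binder hN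
(`stub_a3NonComm`, non-commutation of the two local monodromies at a symmetric `A₃` point) of crux K1-B
`VeryGeneralSignCommutatorsInHg` (`Summits/HodgeConjecture/HodgeConjecture/Theses/SignSymmetricPowers.lean`,
stmt-HodgeConjecture-19716). Sequel of prover-Ax's `HomologySelfMapFixingOpenSet` (the variation of `h` factors through the
local piece) and `CohomologySelfMapTransferOfField` (Kronecker duality over a field).

**Setting.** `X = A ∪ B` an open cover, `h : X → X` continuous with `h = id` on `B` and `h(A) ⊆ A`, restriction `h_A`;
coefficients in a field `F`; `Hₙ(X; F)` and `Hₙ(A; F)` finite-dimensional.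

**Results.**
* §1 (linear algebra) `LinearMap.trace_eq_of_comp_eq_of_range_le_of_ker_le` — if `ι : W → V`, `N ∈ End V`, `N' ∈ End W`
  satisfy `N ∘ ι = ι ∘ N'`, `im N ⊆ im ι` and `N' = 0` on `ker ι`, then `tr N = tr N'` (a section of `ι` over its image
  gives `ρ` with `ι ∘ ρ = N`, and `ρ ∘ ι − N'` is square-zero; `tr(ιρ) = tr(ρι)`).
* §2 `singularHomology.map_sub_self_eq_zero_of_mem_ker_of_eqOn` — **`(h_A)_* − 1` vanishes on
  `ker (Hₙ(A) → Hₙ(X)) = ∂ Hₙ₊₁(X, A)`**: `h` acts trivially on `Hₙ₊₁(X, A)` by excision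
  (`relativeSingularHomology.map_eq_self_of_eqOn`) and `∂` is natural.
* §2 **`singularHomology.trace_map_sub_id_eq_of_eqOn`** — `tr(h_* − 1 | Hₙ(X; F)) = tr((h_A)_* − 1 | Hₙ(A; F))`:
  the LEFSCHETZ NUMBER LOCALISES, `Λ(h) − χ(X) = Λ(h_A) − χ(A)` degree by degree (Dold's additivity of the fixed-point
  index / AGZV II §1.1 "`h_* = id + var ∘ i_*`" read through `tr(var ∘ i_*) = tr(i_* ∘ var)`).
* §3 `singularCohomology.trace_sub_id_eq_of_eqOn` — the same for every automorphism `T` of `Hⁿ(X; F)` acting as `h^*`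
  (Kronecker duality: `tr(h^* − 1) = tr(h_* − 1)`), and
  `singularCohomology.trace_sub_id_eq_of_eqOn_of_homologyConj` — with the local trace read on a MODEL `μ : F₀ → F₀`
  through a chart `e : A → F₀` bijective on `Hₙ` with `e ∘ h_A ≃ μ ∘ e`: `tr(T − 1 | Hⁿ(X)) = tr(μ_* − 1 | Hₙ(F₀))`.

Use (programme A₃-TRACE): the monodromy homeomorphism of a nearby fibre around an isolated critical point is the identity
off a Milnor ball and conjugate on the ball to the weighted rotation of the Pham–Brieskorn fibre, so the TRACE of the
monodromy on `Hⁿ` is `bₙ + tr(rotation_* | Hₙ(F₀)) − μ` — for a node `bₙ + (−1)^{n+1} − 1` (so the monodromy is `≠ 1` for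
even `n`: the rider of the one-node Picard–Lefschetz binder), for an `A₃` point `bₙ + (−1)^{n+1} − 3`.

## References

* [HatcherAT2002] A. Hatcher, Algebraic Topology, CUP 2002, §2.1 Thm. 2.13 ff. (exact sequence of the pair, naturality of
  `∂`), Thm. 2.20 (excision), §2.C (Lefschetz numbers), §3.1 p. 201 (Kronecker duality).
* [ArnoldGuseinzadeVarchenko2012] V. I. Arnold, S. M. Gusein-Zade, A. N. Varchenko, Singularities of Differentiable Maps,
  Vol. 2, Part I §1.1 (variation operator, `h_* = id + var ∘ i_*`; held text p0013, p0025), §2.3.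
-/

noncomputable section

open CategoryTheory Limits Set

universe u v

/-! ### §1 Linear algebra: traces of semiconjugate endomorphisms -/

namespace LinearMap

variable {F : Type*} [Field F] {V W : Type*} [AddCommGroup V] [Module F V] [AddCommGroup W] [Module F W]
  [FiniteDimensional F V] [FiniteDimensional F W]

/-- **Traces of semiconjugate endomorphisms agree.** If `ι : W → V`, `N ∈ End V`, `N' ∈ End W` (finite-dimensional
vector spaces) satisfy `N ∘ ι = ι ∘ N'`, `im N ⊆ im ι` and `ker ι ⊆ ker N'`, then `tr N = tr N'`: for a linear section
`s` of `ι` over its image, `ρ := s ∘ N` satisfies `ι ∘ ρ = N`, and `E := ρ ∘ ι − N'` has image in `ker ι` and kills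
`ker ι`, so `E² = 0`, `tr E = 0`, and `tr N = tr(ι ∘ ρ) = tr(ρ ∘ ι) = tr N' + tr E`.
[cite: HatcherAT2002, §2.C (Lefschetz numbers: traces and exact sequences)] -/
theorem trace_eq_of_comp_eq_of_range_le_of_ker_le (ι : W →ₗ[F] V) (N : V →ₗ[F] V) (N' : W →ₗ[F] W)
    (hcomm : N ∘ₗ ι = ι ∘ₗ N') (hrange : LinearMap.range N ≤ LinearMap.range ι)
    (hker : LinearMap.ker ι ≤ LinearMap.ker N') :
    LinearMap.trace F V N = LinearMap.trace F W N' := by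
  -- a linear section of `ι` over its image
  obtain ⟨s, hs⟩ := ι.rangeRestrict.exists_rightInverse_of_surjective ι.range_rangeRestrict
  -- `ρ := s ∘ N`, `N` co-restricted to `im ι`
  let Nc : V →ₗ[F] ↥(LinearMap.range ι) := LinearMap.codRestrict (LinearMap.range ι) N fun v => hrange ⟨v, rfl⟩
  let ρ : V →ₗ[F] W := s ∘ₗ Nc
  have hιs : ∀ y : ↥(LinearMap.range ι), ι (s y) = y := fun y => by
    have h1 : ι.rangeRestrict (s y) = y := by
      rw [← LinearMap.comp_apply, hs, LinearMap.id_apply]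
    have h2 : ((ι.rangeRestrict (s y) : ↥(LinearMap.range ι)) : V) = ι (s y) := rfl
    rw [← h2, h1]
  have hιρ : ι ∘ₗ ρ = N := by
    refine LinearMap.ext fun v => ?_
    change ι (s (Nc v)) = N v
    rw [hιs]
    rfl
  -- `E := ρ ∘ ι − N'` is square-zero
  have hE₁ : ∀ w, ι ((ρ ∘ₗ ι - N') w) = 0 := fun w => by
    have h1 : ι (ρ (ι w)) = N (ι w) := by rw [← LinearMap.comp_apply ι ρ, hιρ]
    have h2 : N (ι w) = ι (N' w) := by
      rw [← LinearMap.comp_apply N ι, hcomm, LinearMap.comp_apply]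
    rw [LinearMap.sub_apply, LinearMap.comp_apply, map_sub, h1, h2, sub_self]
  have hE₂ : ∀ w, ι w = 0 → (ρ ∘ₗ ι - N') w = 0 := fun w hw => by
    have h1 : N' w = 0 := hker (LinearMap.mem_ker.2 hw)
    rw [LinearMap.sub_apply, LinearMap.comp_apply, hw, map_zero, h1, sub_zero]
  have hEsq : (ρ ∘ₗ ι - N') * (ρ ∘ₗ ι - N') = 0 :=
    LinearMap.ext fun w => by rw [Module.End.mul_apply, LinearMap.zero_apply]; exact hE₂ _ (hE₁ w)
  have htrE : LinearMap.trace F W (ρ ∘ₗ ι - N') = 0 := by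
    have hnil : IsNilpotent (ρ ∘ₗ ι - N') := ⟨2, by rw [pow_two, hEsq]⟩
    exact (LinearMap.isNilpotent_trace_of_isNilpotent hnil).eq_zero
  calc LinearMap.trace F V N = LinearMap.trace F V (ι ∘ₗ ρ) := by rw [hιρ]
    _ = LinearMap.trace F W (ρ ∘ₗ ι) := (LinearMap.trace_comp_comm' ι ρ).symm
    _ = LinearMap.trace F W ((ρ ∘ₗ ι - N') + N') := by rw [sub_add_cancel]
    _ = LinearMap.trace F W N' := by rw [map_add, htrE, zero_add]

end LinearMap

namespace Literature.AlgebraicTopology.SingularHomology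

/-! ### §2 Homology: the trace of the variation localises -/

namespace singularHomology

variable (R : Type v) [CommRing R] (M : Type v) [AddCommGroup M] [Module R M]
  {X : Type u} [TopologicalSpace X]

/-- **The local variation vanishes on the classes that die in `X`**: for an open cover `X = A ∪ B`, `h = id` on `B`,
`h(A) ⊆ A` with restriction `h_A`, and `a ∈ Hₙ(A; M)` with `ι_{A*} a = 0` in `Hₙ(X; M)`: `(h_A)_* a = a`. Indeed
`a = ∂ y` for some `y ∈ Hₙ₊₁(X, A)` (exactness), `h` acts trivially on `Hₙ₊₁(X, A)` (excision from `(B, A ∩ B)`,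
`relativeSingularHomology.map_eq_self_of_eqOn`), and `(h_A)_* ∂ y = ∂ (h_* y)` (naturality of `∂`).
[cite: HatcherAT2002, §2.1 Thm. 2.13 ff. (naturality of ∂) and Thm. 2.20]
[cite: ArnoldGuseinzadeVarchenko2012, Part I §1.1 (held text p0013)] -/
theorem map_sub_self_eq_zero_of_mem_ker_of_eqOn {A B : Set X} (hAo : IsOpen A) (hBo : IsOpen B)
    (hAB : A ∪ B = univ) (h : C(X, X)) (hB : ∀ x ∈ B, h x = x) (hA : C(↥A, ↥A))
    (hhA : ∀ a : ↥A, ((hA a : ↥A) : X) = h a) (n : ℕ) (a : singularHomology R M (↥A) n)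
    (ha : map R M (subsetIncl A) n a = 0) : map R M hA n a - a = 0 := by
  have hmaps : Set.MapsTo h A A := fun a ha => by
    have := (hA ⟨a, ha⟩).2
    rwa [hhA ⟨a, ha⟩] at this
  have hres : subsetRestrict h hmaps = hA := by
    ext a
    exact (hhA a).symm
  -- `a = ∂ y`
  have hex := (relativeSingularHomology.exact_δ_map R M A n).moduleCat_range_eq_ker
  have ha' : a ∈ LinearMap.ker (map R M (⟨Subtype.val, continuous_subtype_val⟩ : C(↥A, X)) n).hom := by
    rw [LinearMap.mem_ker]; exact ha
  rw [← hex] at ha'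
  obtain ⟨y, rfl⟩ := ha'
  -- naturality of `∂` and triviality of `h` on `Hₙ₊₁(X, A)`
  change map R M hA n (relativeSingularHomology.δ R M X A n y) - relativeSingularHomology.δ R M X A n y = 0
  rw [← hres, ← ModuleCat.comp_apply, relativeSingularHomology.δ_naturality R M h hmaps n, ModuleCat.comp_apply,
    relativeSingularHomology.map_eq_self_of_eqOn R M hAo hBo hAB h hB hmaps, sub_self]

variable (F : Type v) [Field F]

/-- **The Lefschetz trace localises to the invariant piece.** For an open cover `X = A ∪ B`, a continuous
`h : X → X` with `h = id` on `B` and `h(A) ⊆ A` (restriction `h_A`), a field `F`, and `Hₙ(X; F)`, `Hₙ(A; F)`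
finite-dimensional: **`tr(h_* − 1 | Hₙ(X; F)) = tr((h_A)_* − 1 | Hₙ(A; F))`**, i.e. `Λ(h) − χ(X) = Λ(h_A) − χ(A)`
degree by degree — the variation `h_* − 1` factors as `ι_{A*} ∘ ρ` with `ρ ∘ ι_{A*} = (h_A)_* − 1` up to a square-zero
error supported on `ker ι_{A*}` (`map_sub_self_mem_range_of_eqOn`, `map_sub_self_eq_zero_of_mem_ker_of_eqOn`), and
`tr(ι ∘ ρ) = tr(ρ ∘ ι)`. [cite: HatcherAT2002, §2.C (Lefschetz numbers) and §2.1 Thm. 2.20]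
[cite: ArnoldGuseinzadeVarchenko2012, Part I §1.1 (h_* = id + var ∘ i_*; held text p0013, p0025)] -/
theorem trace_map_sub_id_eq_of_eqOn {A B : Set X} (hAo : IsOpen A) (hBo : IsOpen B) (hAB : A ∪ B = univ)
    (h : C(X, X)) (hB : ∀ x ∈ B, h x = x) (hA : C(↥A, ↥A)) (hhA : ∀ a : ↥A, ((hA a : ↥A) : X) = h a) (n : ℕ)
    [Module.Finite F (singularHomology F F X n)] [Module.Finite F (singularHomology F F (↥A) n)] :
    LinearMap.trace F _ ((map F F h n).hom - LinearMap.id) =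
      LinearMap.trace F _ ((map F F hA n).hom - LinearMap.id) := by
  have hmaps : Set.MapsTo h A A := fun a ha => by
    have := (hA ⟨a, ha⟩).2
    rwa [hhA ⟨a, ha⟩] at this
  refine LinearMap.trace_eq_of_comp_eq_of_range_le_of_ker_le (map F F (subsetIncl A) n).hom _ _ ?_ ?_ ?_
  · refine LinearMap.ext fun a => ?_
    rw [LinearMap.comp_apply, LinearMap.comp_apply, LinearMap.sub_apply, LinearMap.sub_apply, LinearMap.id_apply,
      LinearMap.id_apply, map_sub]
    exact congrArg (· - _) (map_map_subsetIncl F F h hA hhA n a)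
  · rintro _ ⟨x, rfl⟩
    exact map_sub_self_mem_range_of_eqOn F F hAo hBo hAB h hB hmaps n x
  · intro a ha
    rw [LinearMap.mem_ker] at ha ⊢
    rw [LinearMap.sub_apply, LinearMap.id_apply]
    exact map_sub_self_eq_zero_of_mem_ker_of_eqOn F F hAo hBo hAB h hB hA hhA n a ha

/-- **Transfer along a chart bijective on homology**: if `e : A → F₀` induces a bijection `Hₙ(A; F) → Hₙ(F₀; F)`,
`Hₙ(F₀; F)` is finite-dimensional, and `e ∘ g ≃ μ ∘ e`, then `tr(g_* − 1 | Hₙ(A)) = tr(μ_* − 1 | Hₙ(F₀))`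
(homotopy invariance and conjugation invariance of the trace). [cite: HatcherAT2002, §2.1 Thm. 2.10 and §2.C] -/
theorem trace_map_sub_id_eq_of_homologyConj (n : ℕ) {A F₀ : Type u} [TopologicalSpace A] [TopologicalSpace F₀]
    (e : C(A, F₀)) (hbij : Function.Bijective (map F F e n).hom) (g : C(A, A)) (μ : C(F₀, F₀))
    (hconj : (e.comp g).Homotopic (μ.comp e)) [Module.Finite F (singularHomology F F F₀ n)] :
    LinearMap.trace F _ ((map F F g n).hom - LinearMap.id) =
      LinearMap.trace F _ ((map F F μ n).hom - LinearMap.id) := by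
  let E : singularHomology F F A n ≃ₗ[F] singularHomology F F F₀ n := LinearEquiv.ofBijective (map F F e n).hom hbij
  haveI : Module.Finite F (singularHomology F F A n) := Module.Finite.equiv E.symm
  have hnat : (map F F e n).hom ∘ₗ (map F F g n).hom = (map F F μ n).hom ∘ₗ (map F F e n).hom := by
    refine LinearMap.ext fun a => ?_
    rw [LinearMap.comp_apply, LinearMap.comp_apply, ← ModuleCat.comp_apply, ← map_comp, ← ModuleCat.comp_apply,
      ← map_comp, map_eq_of_homotopic F F hconj n]
  have hconjE : E.conj ((map F F g n).hom - LinearMap.id) = (map F F μ n).hom - LinearMap.id := by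
    refine LinearMap.ext fun y => ?_
    obtain ⟨a, rfl⟩ := E.surjective y
    rw [LinearEquiv.conj_apply_apply, E.symm_apply_apply, LinearMap.sub_apply, LinearMap.id_apply, map_sub,
      LinearMap.sub_apply, LinearMap.id_apply]
    congr 1
    exact LinearMap.congr_fun hnat a
  rw [← hconjE, LinearMap.trace_conj']

end singularHomology

/-! ### §3 Cohomology: the trace of `h^* − 1` over a field -/

namespace singularCohomology

variable (F : Type v) [Field F] {X : Type u} [TopologicalSpace X]

/-- **Kronecker duality for traces**: over a field, for `Hₙ(X; F)` finite-dimensional and any continuous self-map `h`,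
`tr(h^* − 1 | Hⁿ(X; F)) = tr(h_* − 1 | Hₙ(X; F))` (`κ ∘ (h^* − 1) = (h_* − 1)ᵀ ∘ κ` with `κ` bijective, and
`tr fᵀ = tr f`). [cite: HatcherAT2002, §3.1 Thm. 3.2 (p. 195) and p. 201] -/
theorem trace_map_sub_id_eq_trace_homologyMap_sub_id (h : C(X, X)) (n : ℕ)
    [Module.Finite F (singularHomology F F X n)] :
    LinearMap.trace F _ ((singularCohomology.map F F h n).hom - LinearMap.id) =
      LinearMap.trace F _ ((singularHomology.map F F h n).hom - LinearMap.id) := by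
  have hκ := kroneckerPairing_bijective_of_field F X n
  let K : singularCohomology F F X n ≃ₗ[F] Module.Dual F (singularHomology F F X n) :=
    LinearEquiv.ofBijective (kroneckerPairing F F X n) hκ
  haveI : Module.Finite F (singularCohomology F F X n) := Module.Finite.equiv K.symm
  have hconj : K.conj ((singularCohomology.map F F h n).hom - LinearMap.id) =
      ((singularHomology.map F F h n).hom - LinearMap.id).dualMap := by
    refine LinearMap.ext fun y => ?_
    obtain ⟨a, rfl⟩ := K.surjective y
    rw [LinearEquiv.conj_apply_apply, K.symm_apply_apply]
    exact LinearMap.congr_fun (kroneckerPairing_comp_cohomologyMap_sub_id F h n) a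
  rw [← LinearMap.trace_conj' _ K, hconj, LinearMap.dualMap_def, LinearMap.trace_transpose']

/-- **The cohomological Lefschetz trace localises**: for an open cover `X = A ∪ B`, `h = id` on `B`, `h(A) ⊆ A`
(restriction `h_A`), a field `F`, `Hₙ(X; F)` and `Hₙ(A; F)` finite-dimensional, and ANY automorphism `T` of `Hⁿ(X; F)`
acting as `h^*`: **`tr(T − 1) = tr((h_A)_* − 1 | Hₙ(A; F))`**.
[cite: HatcherAT2002, §2.C, §2.1 Thm. 2.20 and §3.1 p. 201]
[cite: ArnoldGuseinzadeVarchenko2012, Part I §1.1 (held text p0013, p0025)] -/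
theorem trace_sub_id_eq_of_eqOn {A B : Set X} (hAo : IsOpen A) (hBo : IsOpen B) (hAB : A ∪ B = univ)
    (h : C(X, X)) (hB : ∀ x ∈ B, h x = x) (hA : C(↥A, ↥A)) (hhA : ∀ a : ↥A, ((hA a : ↥A) : X) = h a) (n : ℕ)
    [Module.Finite F (singularHomology F F X n)] [Module.Finite F (singularHomology F F (↥A) n)]
    (T : singularCohomology F F X n ≃ₗ[F] singularCohomology F F X n)
    (hT : ∀ x, T x = (singularCohomology.map F F h n).hom x) :
    LinearMap.trace F _ ((T : singularCohomology F F X n →ₗ[F] singularCohomology F F X n) - LinearMap.id) =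
      LinearMap.trace F _ ((singularHomology.map F F hA n).hom - LinearMap.id) := by
  have hT' : (T : singularCohomology F F X n →ₗ[F] singularCohomology F F X n) = (singularCohomology.map F F h n).hom :=
    LinearMap.ext fun x => hT x
  rw [hT', trace_map_sub_id_eq_trace_homologyMap_sub_id F h n,
    singularHomology.trace_map_sub_id_eq_of_eqOn F hAo hBo hAB h hB hA hhA n]

/-- **The cohomological Lefschetz trace, read on a model**: in the setting of `trace_sub_id_eq_of_eqOn`, if moreover
`e : A → F₀` is bijective on `Hₙ( · ; F)`, `Hₙ(F₀; F)` is finite-dimensional and `e ∘ h_A ≃ μ ∘ e` for a model self-map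
`μ` of `F₀`, then **`tr(T − 1 | Hⁿ(X; F)) = tr(μ_* − 1 | Hₙ(F₀; F))`** for every `T` acting as `h^*`.
[cite: HatcherAT2002, §2.C, §2.1 Thm. 2.10, Thm. 2.20 and §3.1 p. 201]
[cite: ArnoldGuseinzadeVarchenko2012, Part I §1.1 and §2.3 (held text p0013, p0025)] -/
theorem trace_sub_id_eq_of_eqOn_of_homologyConj {A B : Set X} (hAo : IsOpen A) (hBo : IsOpen B)
    (hAB : A ∪ B = univ) (h : C(X, X)) (hB : ∀ x ∈ B, h x = x) (hA : C(↥A, ↥A))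
    (hhA : ∀ a : ↥A, ((hA a : ↥A) : X) = h a) (n : ℕ) [Module.Finite F (singularHomology F F X n)]
    {F₀ : Type u} [TopologicalSpace F₀] (e : C(↥A, F₀))
    (hbij : Function.Bijective (singularHomology.map F F e n).hom) (μ : C(F₀, F₀))
    (hconj : (e.comp hA).Homotopic (μ.comp e)) [Module.Finite F (singularHomology F F F₀ n)]
    (T : singularCohomology F F X n ≃ₗ[F] singularCohomology F F X n)
    (hT : ∀ x, T x = (singularCohomology.map F F h n).hom x) :
    LinearMap.trace F _ ((T : singularCohomology F F X n →ₗ[F] singularCohomology F F X n) - LinearMap.id) =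
      LinearMap.trace F _ ((singularHomology.map F F μ n).hom - LinearMap.id) := by
  haveI : Module.Finite F (singularHomology F F (↥A) n) :=
    Module.Finite.equiv (LinearEquiv.ofBijective (singularHomology.map F F e n).hom hbij).symm
  rw [trace_sub_id_eq_of_eqOn F hAo hBo hAB h hB hA hhA n T hT,
    singularHomology.trace_map_sub_id_eq_of_homologyConj F n e hbij hA μ hconj]

end singularCohomology

end Literature.AlgebraicTopology.SingularHomology

end
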